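import Literature.NumberTheory.LFunctions.DobnerSelbergClassSteepest
import Literature.NumberTheory.LFunctions.DobnerLemma1Proofs
import Literature.NumberTheory.LFunctions.DobnerLemma4Proofs
import HarnessLib

/-!
# Dobner's Lemma 4 for `F ∈ 𝒮♯`: the saddle-point segment (Lemma 5 applied, Gaussian main term)

RH-FREE literature PROOFS (no definitions, no named facts). Trunk T-ANT
(`Literature/NumberTheory/LFunctions`); node **L4c-S** of the Dobner-T2 (`𝒮♯`) programme of cell
rh-crit (plan of record HOME/drafts/rt/t7-N1-PLAN.md §3, rt-lead rulings (22)/(26), rt/STATUS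
2026-08-26): the steepest-descent analysis ON THE SEGMENT `M` through the saddle point, i.e. parts
(i)/(ii) of Dobner's Lemma 4 for the truncated integral
`(π|t|)^{−1/2} ∫_{−Y}^{Y} 𝓘(c + iu) du` (`c = s + log n/(2A)`, `Y = (Im s)^{2/3}`) in place of
`B_{t,n}(s)`. The companion files treat the large-`n` tail (L4a,
`DobnerSelbergClassSteepestLargeProofs.lean`), the rectangle contour `V₁, H₁, H₂, V₂` (L4b,
`DobnerSelbergClassSteepestContourProofs.lean`), and the assembly of Lemma 4♯
(`DobnerSelbergClassLemma4Proofs.lean`). Objects: `DobnerSelbergClassSteepest.lean`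
(`ExtendedSelbergDatum.dobnerJ/dobnerGammaT/dobnerA/dobnerShift/dobnerCenter/dobnerI/dobnerB/
dobnerMainTerm`). The `F = ζ` case is the tree file `DobnerLemma4Proofs.lean`, whose GENERIC lemmas
(`Literature.NumberTheory.LFunctions.dobner_M_estimate`, `norm_gaussConst_sub_one_le`,
`norm_cexp_neg_log_sq_div_le`, `norm_delta_le`, `norm_cexp_sub_one_le`,
`norm_poly_ratio_sub_one_le`, …) are reused verbatim and whose `ζ`-specific steps are ported here
line by line.

> A. Dobner, *A proof of Newman's conjecture for the extended Selberg class*, Acta Arith. 201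
> (2021) = arXiv:2005.05142 (held; page numbers of the 18-page arXiv text). **Lemma 5** (p. 11):
> "`γ(z) = γ(z₀) exp((log Q + ∑ⱼ ωⱼ Log(ωⱼ z₀))(z − z₀) + (∑ⱼωⱼ/(2z₀))(z − z₀)²)
> (1 + O((1 + |z − z₀|)/|z₀| + |z − z₀|³/|z₀|²))`" for `|z − z₀| ≤ D|z₀|^{2/3}` away from the poles;
> proof of Lemma 4 (i)/(ii), pp. 11–12: "the `M` integral … Parametrizing `M` as
> `z(u) = s + (1/2A) log n + ui` for `u = −y^{2/3}` to `u = y^{2/3}` … (4.4) equals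
> `γ_t(s) exp(−log² n/(4A)) n^{−s} (π|t|)^{−1/2} ∫_{−y^{2/3}}^{y^{2/3}} exp(−Au²)(1 + O((1+|u|³)/y^{1/5})) du`
> … the main term is `γ_t(s) exp(−log² n/(4A)) n^{−s} (π|t|)^{−1/2}(π/A)^{1/2}` … (4.6), (4.7)";
> §4.1 eq. (4.9), p. 14: "`|γ_t(s)| = |γ(s)||exp((s − J_t(s))²/|t|)| ≫ e^{−K′y}`".

## Contents (all proved; `D : ExtendedSelbergDatum`)

* `ExtendedSelbergDatum.dobnerI_center_eq` — **Lemma 5♯ applied**: for `z = s + ζ`,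
  `𝓘(s+ζ) = γ_t(s) n^{−s} e^{Aζ² − ζ log n} · ((s+ζ)(s+ζ−1)/(s(s−1)))ᵐ e^{E}`,
  `‖E‖ ≤ ∑ᵢ(εᵢ‖ωᵢζ‖ + 2‖ωᵢζ‖³/‖ωᵢs+μᵢ‖²)`, one application of
  `Literature.Analysis.SpecialFunctions.Complex.Gamma_eq_mul_exp_taylor` per factor `Γ(ωᵢ z + μᵢ)`;
  the linear Taylor terms cancel EXACTLY against the Gaussian by the definition of the tree's `J_t`
  (exact-cancellation variant, `DobnerSelbergClassSteepest.lean` "DEVIATION FROM PRINT", admitted by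
  rt-lead ruling (15)(c)) and the quadratic terms assemble to `A = 1/|t| + ∑ᵢ ωᵢ²/(2(ωᵢ s + μᵢ))`;
* `ExtendedSelbergDatum.dobnerA_sq_sub_on_segment` — completing the square on `ζ = λ + iu`;
* `ExtendedSelbergDatum.norm_digamma_sub_log_le_factor`, `factor_error_le` — the hypothesis
  `‖ψ − Log‖ ≤ 5/(ωᵢ Im s)` of Lemma 5♯ on each segment and the resulting size
  `‖Eᵢ‖ ≤ 5‖ζ‖/y + 8ωᵢ‖ζ‖³/y²` (so `‖E‖ ≤ 5k‖ζ‖/y + 8W‖ζ‖³/y²`, `W = ∑ωᵢ`);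
* `ExtendedSelbergDatum.dobner_segment_bound` — **the pointwise relative error (4.4)–(4.5)** on
  `M`: `‖𝓘(c+iu) − main_A e^{−Au²}‖ ≤ ‖main_A‖ K₁(1+|u|³) y^{−1/5} e^{−(Re A)u²}` with the EXPLICIT
  constant `K₁ = e^{2k+64W}(8·2ᵐ + 20k + 64W)` (`k` = number of `Γ`-factors, `m` = polar order),
  under explicit largeness conditions on `y = Im s`;
* `ExtendedSelbergDatum.norm_dobnerMainTerm_eq`; `ExtendedSelbergDatum.continuousOn_dobnerI_segment`;
* `ExtendedSelbergDatum.exists_exp_neg_mul_le_norm_dobnerGammaT` — **the lower bound (4.9)**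
  `e^{−K′y} ≤ ‖γ_t(s)‖` on `|Re s| ≤ C(Im s)^{1/4}` (Dobner's Lemma 1, lower half, `θ = 1/4`, =
  `Literature.NumberTheory.LFunctions.dobner_lemma1_holds`; Gaussian part
  `Re((s−J)²) ≥ −(|t|/2)²(∑ωᵢ arg(ωᵢs+μᵢ))² ≥ −|t|²π²W²/4`);
* **`ExtendedSelbergDatum.dobner_lemma4_segment`** — parts (i)/(ii) for the truncated saddle
  integral `M`: for `t < 0`, `C > 0`, eventually in `Im s` (uniformly in `|Re s| ≤ C(Im s)^{1/4}`,
  `n ≥ 1`): (i) `log n ≤ y^{1/3}/|t| ⟹ ‖(π|t|)^{−1/2} M − main‖ ≤ K y^{−1/5} ‖main‖`;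
  (ii) `log n ≤ y^{3/5}/|t| ⟹ ‖(π|t|)^{−1/2} M‖ ≤ K‖γ_t(s)‖e^{−(|t|/8)log²n} n^{−Re s}` and the
  absorption bound `e^{−y^{4/3}/(18|t|)} ≤ y^{−1/5}‖main‖` for the contour error of L4b.

Constants: where the `ζ` file has the numerals `9/y`, `42e^{17}`, `1/(4s)`, this file carries the
datum-dependent but explicit `5/(ωᵢy)`, `K₁(D)`, `∑ωᵢ²/(2(ωᵢs+μᵢ))`; the largeness thresholds
depend on `D` through `poleHeight`, `∑ωᵢ`, `min ωᵢ` and are produced by the `eventually_*_rpow`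
helpers of `DobnerLemma4Tools.lean`. Two long explicit-constant proofs carry raised
`maxHeartbeats`, as in the `ζ` file.

bears_on: N-C/N-P (COLUMN 3 DBN). WHAT THIS IS NOT: steepest-descent bookkeeping for a Gaussian
contour integral inside the re-proof, in `𝒮♯`-generality, of an RH-free theorem (`Λ_F ≥ 0`) whose
`ζ`-case is already the kernel theorem `Literature.NumberTheory.LFunctions.rodgers_tao_holds`;
nothing here bears on the truth of RH.

## References

* [Dobner2021] A. Dobner, Acta Arith. 201 (2021), 29–62 = arXiv:2005.05142: Lemma 4 (p. 10),
  Lemmas 5–7 (p. 11), proof of Lemma 4 (i)/(ii) eqs. (4.2)–(4.7) (pp. 11–12), §4.1 eq. (4.9)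
  (p. 14), §5 proof of Lemma 5 (pp. 16–17).
-/

noncomputable section

open Complex Filter Topology Set MeasureTheory intervalIntegral

namespace Literature.NumberTheory.LFunctions

namespace ExtendedSelbergDatum

variable (D : ExtendedSelbergDatum)



/-! ## The factorisation of the integrand near `s` (Lemma 5 applied to every `Γ`-factor) -/

/-- **Factorisation of `𝓘` near `s`** ([Dobner2021, Lemma 5] for `F ∈ 𝒮♯`, one application of
`Literature.Analysis.SpecialFunctions.Complex.Gamma_eq_mul_exp_taylor` per factor
`Γ(ωᵢ z + μᵢ)` at `w₀ = ωᵢ s + μᵢ`, `d = ωᵢ ζ`, combined with the design of `J_t` and `A`): if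
`Im s`, `Im(s+ζ)` exceed the pole height, `‖ωᵢζ‖ ≤ ‖ωᵢ s + μᵢ‖/2` and `‖ψ − Log‖ ≤ εᵢ` on each
segment `[ωᵢ s + μᵢ, ωᵢ(s+ζ) + μᵢ]`, then
`𝓘(s+ζ) = γ_t(s) n^{−s} e^{Aζ² − ζ log n} · ((s+ζ)(s+ζ−1)/(s(s−1)))ᵐ e^{E}` with
`‖E‖ ≤ ∑ᵢ (εᵢ‖ωᵢζ‖ + 2‖ωᵢζ‖³/‖ωᵢ s + μᵢ‖²)`; the linear Taylor terms cancel EXACTLY by the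
definition of `J_t` (exact-cancellation variant) and the quadratic ones assemble to `A`.
[cite: Dobner2021, Lemma 5 and eq. (4.2)–(4.4), p. 11] -/
theorem dobnerI_center_eq {t : ℝ} (ht : t ≠ 0) {n : ℕ} (hn : 1 ≤ n) {s ζ : ℂ}
    (hs : D.poleHeight < s.im) (hsζ : D.poleHeight < (s + ζ).im)
    (hd : ∀ i, ‖(D.omega i : ℂ) * ζ‖ ≤ ‖(D.omega i : ℂ) * s + D.mu i‖ / 2)
    {ε : Fin D.numGamma → ℝ}
    (hψ : ∀ i, ∀ τ' ∈ Set.Icc (0 : ℝ) 1,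
      ‖Complex.digamma ((D.omega i : ℂ) * s + D.mu i + τ' * ((D.omega i : ℂ) * ζ)) -
        Complex.log ((D.omega i : ℂ) * s + D.mu i + τ' * ((D.omega i : ℂ) * ζ))‖ ≤ ε i) :
    ∃ E : ℂ, ‖E‖ ≤ ∑ i, (ε i * ‖(D.omega i : ℂ) * ζ‖ +
        2 * ‖(D.omega i : ℂ) * ζ‖ ^ 3 / ‖(D.omega i : ℂ) * s + D.mu i‖ ^ 2) ∧
      D.dobnerI t n s (s + ζ) = D.dobnerGammaT t s * (n : ℂ) ^ (-s) *
        Complex.exp (D.dobnerA t s * ζ ^ 2 - (Real.log n : ℂ) * ζ) *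
        (((s + ζ) * (s + ζ - 1) / (s * (s - 1))) ^ D.polarOrder * Complex.exp E) := by
  have ht' : 0 < |t| := abs_pos.2 ht
  have hs0' : 0 < s.im := lt_of_le_of_lt D.poleHeight_nonneg hs
  have hs0 : s ≠ 0 := fun h ↦ by rw [h] at hs0'; simp at hs0'
  have hs1 : s - 1 ≠ 0 := fun h ↦ by
    have := congrArg Complex.im h; simp at this; linarith
  have hn0 : (n : ℂ) ≠ 0 := by exact_mod_cast (show n ≠ 0 by omega)
  have hQ0 : (D.Q : ℂ) ≠ 0 := by exact_mod_cast D.Q_pos.ne'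
  -- one `Γ`-factor at a time (Lemma 5 via `ψ`)
  have key : ∀ i, ∃ E : ℂ, ‖E‖ ≤ ε i * ‖(D.omega i : ℂ) * ζ‖ +
        2 * ‖(D.omega i : ℂ) * ζ‖ ^ 3 / ‖(D.omega i : ℂ) * s + D.mu i‖ ^ 2 ∧
      Complex.Gamma ((D.omega i : ℂ) * (s + ζ) + D.mu i) =
        Complex.Gamma ((D.omega i : ℂ) * s + D.mu i) *
          Complex.exp (Complex.log ((D.omega i : ℂ) * s + D.mu i) * ((D.omega i : ℂ) * ζ) +
            ((D.omega i : ℂ) * ζ) ^ 2 / (2 * ((D.omega i : ℂ) * s + D.mu i)) + E) := by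
    intro i
    have e : (D.omega i : ℂ) * (s + ζ) + D.mu i =
        (D.omega i : ℂ) * s + D.mu i + (D.omega i : ℂ) * ζ := by ring
    have h₁ : 0 < ((D.omega i : ℂ) * s + D.mu i + (D.omega i : ℂ) * ζ).im := by
      rw [← e]; exact D.im_omega_mul_add_mu_pos i hsζ
    obtain ⟨E, hE, hΓ⟩ := Literature.Analysis.SpecialFunctions.Complex.Gamma_eq_mul_exp_taylor
      (D.im_omega_mul_add_mu_pos i hs) h₁ (hd i) (hψ i)
    exact ⟨E, hE, by rw [e, hΓ]⟩
  choose E hE hΓ using key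
  refine ⟨∑ i, E i, (norm_sum_le _ _).trans (Finset.sum_le_sum fun i _ ↦ hE i), ?_⟩
  -- the product of the `Γ`-factors
  set L₁ : ℂ := ∑ i, (D.omega i : ℂ) * Complex.log ((D.omega i : ℂ) * s + D.mu i) with hL₁
  set A₁ : ℂ := ∑ i, ((D.omega i : ℂ) ^ 2) / (2 * ((D.omega i : ℂ) * s + D.mu i)) with hA₁
  have hprod : ∏ i, Complex.Gamma ((D.omega i : ℂ) * (s + ζ) + D.mu i) =
      (∏ i, Complex.Gamma ((D.omega i : ℂ) * s + D.mu i)) *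
        Complex.exp (L₁ * ζ + A₁ * ζ ^ 2 + ∑ i, E i) := by
    rw [Finset.prod_congr rfl fun i _ ↦ hΓ i, Finset.prod_mul_distrib, ← Complex.exp_sum]
    congr 2
    have e2 : ∀ i, Complex.log ((D.omega i : ℂ) * s + D.mu i) * ((D.omega i : ℂ) * ζ) +
          ((D.omega i : ℂ) * ζ) ^ 2 / (2 * ((D.omega i : ℂ) * s + D.mu i)) + E i =
        ((D.omega i : ℂ) * Complex.log ((D.omega i : ℂ) * s + D.mu i)) * ζ +
          (((D.omega i : ℂ) ^ 2) / (2 * ((D.omega i : ℂ) * s + D.mu i))) * ζ ^ 2 + E i := by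
      intro i; ring
    rw [Finset.sum_congr rfl fun i _ ↦ e2 i, Finset.sum_add_distrib, Finset.sum_add_distrib,
      ← Finset.sum_mul, ← Finset.sum_mul]
  -- the polynomial factor
  set P : ℂ := (s + ζ) * (s + ζ - 1) / (s * (s - 1)) with hP
  have hpoly : (s + ζ) ^ D.polarOrder * (s + ζ - 1) ^ D.polarOrder =
      s ^ D.polarOrder * (s - 1) ^ D.polarOrder * P ^ D.polarOrder := by
    have e : s * (s - 1) * P = (s + ζ) * (s + ζ - 1) := by
      rw [hP]; field_simp
    calc (s + ζ) ^ D.polarOrder * (s + ζ - 1) ^ D.polarOrder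
        = ((s + ζ) * (s + ζ - 1)) ^ D.polarOrder := (mul_pow _ _ _).symm
      _ = (s * (s - 1) * P) ^ D.polarOrder := by rw [e]
      _ = s ^ D.polarOrder * (s - 1) ^ D.polarOrder * P ^ D.polarOrder := by rw [mul_pow, mul_pow]
  -- unfold everything
  have hJ : D.dobnerJ t s = s + ((|t| / 2 : ℝ) : ℂ) * ((Real.log D.Q : ℂ) + L₁) := by
    rw [dobnerJ]
  have hA : D.dobnerA t s = ((1 / |t| : ℝ) : ℂ) + A₁ := by rw [dobnerA]
  rw [dobnerI, dobnerGammaT, gamma, gamma, dobnerGamma_apply, dobnerGamma_apply, hprod, hA,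
    hJ, Complex.cpow_def_of_ne_zero hQ0, Complex.cpow_def_of_ne_zero hQ0,
    Complex.cpow_def_of_ne_zero hn0, Complex.cpow_def_of_ne_zero hn0, ← Complex.natCast_log,
    ← Complex.ofReal_log D.Q_pos.le]
  -- collect the exponentials
  set G : ℂ := ∏ i, Complex.Gamma ((D.omega i : ℂ) * s + D.mu i) with hG
  set lQ : ℂ := ((Real.log D.Q : ℝ) : ℂ) with hlQ
  set ln : ℂ := ((Real.log n : ℝ) : ℂ) with hln
  set SE : ℂ := ∑ i, E i with hSE
  have hexp : lQ * (s + ζ) + (L₁ * ζ + A₁ * ζ ^ 2 + SE) + ln * -(s + ζ) +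
      ((1 / |t| : ℝ) : ℂ) * (s + ((|t| / 2 : ℝ) : ℂ) * (lQ + L₁) - (s + ζ)) ^ 2 =
      lQ * s + ((1 / |t| : ℝ) : ℂ) * (s - (s + ((|t| / 2 : ℝ) : ℂ) * (lQ + L₁))) ^ 2 + ln * -s +
        ((((1 / |t| : ℝ) : ℂ) + A₁) * ζ ^ 2 - ln * ζ) + SE := by
    have hτ0 : ((|t| : ℝ) : ℂ) ≠ 0 := by exact_mod_cast ht'.ne'
    push_cast
    field_simp
    ring
  have c4 : ∀ a b c e : ℂ, Complex.exp a * Complex.exp b * Complex.exp c * Complex.exp e =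
      Complex.exp (a + b + c + e) := fun a b c e ↦ by simp only [Complex.exp_add]
  have c5 : ∀ a b c e f : ℂ, Complex.exp a * Complex.exp b * Complex.exp c * Complex.exp e *
      Complex.exp f = Complex.exp (a + b + c + e + f) := fun a b c e f ↦ by
    simp only [Complex.exp_add]
  calc _ = D.alpha * ((s + ζ) ^ D.polarOrder * (s + ζ - 1) ^ D.polarOrder) * G *
        (Complex.exp (lQ * (s + ζ)) * Complex.exp (L₁ * ζ + A₁ * ζ ^ 2 + SE) *
          Complex.exp (ln * -(s + ζ)) *
          Complex.exp (((1 / |t| : ℝ) : ℂ) * (s + ((|t| / 2 : ℝ) : ℂ) * (lQ + L₁) - (s + ζ)) ^ 2)) := by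
        ring
    _ = D.alpha * (s ^ D.polarOrder * (s - 1) ^ D.polarOrder * P ^ D.polarOrder) * G *
        (Complex.exp (lQ * (s + ζ)) * Complex.exp (L₁ * ζ + A₁ * ζ ^ 2 + SE) *
          Complex.exp (ln * -(s + ζ)) *
          Complex.exp (((1 / |t| : ℝ) : ℂ) * (s + ((|t| / 2 : ℝ) : ℂ) * (lQ + L₁) - (s + ζ)) ^ 2)) := by
        rw [hpoly]
    _ = D.alpha * (s ^ D.polarOrder * (s - 1) ^ D.polarOrder * P ^ D.polarOrder) * G *
        Complex.exp (lQ * (s + ζ) + (L₁ * ζ + A₁ * ζ ^ 2 + SE) + ln * -(s + ζ) +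
          ((1 / |t| : ℝ) : ℂ) * (s + ((|t| / 2 : ℝ) : ℂ) * (lQ + L₁) - (s + ζ)) ^ 2) := by rw [c4]
    _ = D.alpha * (s ^ D.polarOrder * (s - 1) ^ D.polarOrder * P ^ D.polarOrder) * G *
        Complex.exp (lQ * s + ((1 / |t| : ℝ) : ℂ) * (s - (s + ((|t| / 2 : ℝ) : ℂ) * (lQ + L₁))) ^ 2 +
          ln * -s + ((((1 / |t| : ℝ) : ℂ) + A₁) * ζ ^ 2 - ln * ζ) + SE) := by rw [hexp]
    _ = D.alpha * (s ^ D.polarOrder * (s - 1) ^ D.polarOrder * P ^ D.polarOrder) * G *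
        (Complex.exp (lQ * s) *
          Complex.exp (((1 / |t| : ℝ) : ℂ) * (s - (s + ((|t| / 2 : ℝ) : ℂ) * (lQ + L₁))) ^ 2) *
          Complex.exp (ln * -s) * Complex.exp ((((1 / |t| : ℝ) : ℂ) + A₁) * ζ ^ 2 - ln * ζ) *
          Complex.exp SE) := by rw [c5]
    _ = _ := by ring

/-- **On the segment `ζ = λ + iu`**: `Aζ² − ζ log n = −log² n/(4A) − A u²` (completing the square,
`λ = log n/(2A)`). [cite: Dobner2021, proof of Lemma 4 (completing the square), p. 11] -/
theorem dobnerA_sq_sub_on_segment {t : ℝ} {s : ℂ} (hA : D.dobnerA t s ≠ 0) (n : ℕ) (u : ℝ) :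
    D.dobnerA t s * (D.dobnerShift t n s + u * I) ^ 2 -
        (Real.log n : ℂ) * (D.dobnerShift t n s + u * I) =
      -((Real.log n : ℂ) ^ 2 / (4 * D.dobnerA t s)) + -(D.dobnerA t s * (u : ℂ) ^ 2) := by
  rw [dobnerShift]
  field_simp
  ring_nf
  rw [Complex.I_sq]
  ring

/-! ## The relative error `Q − 1`, `Q = Pᵐ e^{E}` -/

/-- `‖Pᵐ − 1‖ ≤ (2ᵐ − 1)‖P − 1‖` when `‖P − 1‖ ≤ 1`. [folklore] -/
private theorem norm_pow_sub_one_le_of_norm_sub_one_le {P : ℂ} (hP : ‖P - 1‖ ≤ 1) (m : ℕ) :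
    ‖P ^ m - 1‖ ≤ (2 ^ m - 1) * ‖P - 1‖ := by
  have hP2 : ‖P‖ ≤ 2 := by
    calc ‖P‖ = ‖(P - 1) + 1‖ := by rw [sub_add_cancel]
      _ ≤ ‖P - 1‖ + ‖(1 : ℂ)‖ := norm_add_le _ _
      _ ≤ 2 := by rw [norm_one]; linarith
  induction m with
  | zero => simp
  | succ m ih =>
    have e : P ^ (m + 1) - 1 = P * (P ^ m - 1) + (P - 1) := by ring
    rw [e]
    calc ‖P * (P ^ m - 1) + (P - 1)‖ ≤ ‖P‖ * ‖P ^ m - 1‖ + ‖P - 1‖ := by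
          rw [← norm_mul]; exact norm_add_le _ _
      _ ≤ 2 * ((2 ^ m - 1) * ‖P - 1‖) + ‖P - 1‖ := by
          gcongr
      _ = (2 ^ (m + 1) - 1) * ‖P - 1‖ := by ring

/-- **`‖Pᵐ e^{E} − 1‖ ≤ e^{‖E‖}(2ᵐ ‖P − 1‖ + 2‖E‖)`** when `‖P − 1‖ ≤ 1`. [folklore] -/
private theorem norm_pow_mul_cexp_sub_one_le {P E : ℂ} (hP : ‖P - 1‖ ≤ 1) (m : ℕ) :
    ‖P ^ m * Complex.exp E - 1‖ ≤ Real.exp ‖E‖ * (2 ^ m * ‖P - 1‖ + 2 * ‖E‖) := by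
  have h1 := norm_pow_sub_one_le_of_norm_sub_one_le hP m
  have h2 := norm_cexp_sub_one_le E
  have h3 : ‖Complex.exp E‖ ≤ Real.exp ‖E‖ := Complex.norm_exp_le_exp_norm E
  have h4 : (2 ^ m - 1) * ‖P - 1‖ ≤ 2 ^ m * ‖P - 1‖ := by
    have := norm_nonneg (P - 1); nlinarith
  have e : P ^ m * Complex.exp E - 1 = (P ^ m - 1) * Complex.exp E + (Complex.exp E - 1) := by ring
  rw [e]
  have h1E : (1 : ℝ) ≤ Real.exp ‖E‖ := Real.one_le_exp (norm_nonneg _)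
  calc ‖(P ^ m - 1) * Complex.exp E + (Complex.exp E - 1)‖
      ≤ ‖P ^ m - 1‖ * ‖Complex.exp E‖ + ‖Complex.exp E - 1‖ := by
        rw [← norm_mul]; exact norm_add_le _ _
    _ ≤ 2 ^ m * ‖P - 1‖ * Real.exp ‖E‖ + 2 * ‖E‖ * Real.exp ‖E‖ := by
        gcongr
        exact h1.trans h4
    _ = Real.exp ‖E‖ * (2 ^ m * ‖P - 1‖ + 2 * ‖E‖) := by ring


/-! ## Sizes of the `Γ`-factor data on the saddle segment -/

/-- `‖ωᵢ ζ‖ = ωᵢ ‖ζ‖`. [folklore] -/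
private theorem norm_omega_mul (i : Fin D.numGamma) (ζ : ℂ) :
    ‖(D.omega i : ℂ) * ζ‖ = D.omega i * ‖ζ‖ := by
  rw [norm_mul, Complex.norm_real, Real.norm_eq_abs, abs_of_pos (D.omega_pos i)]

/-- **The `ψ − Log` bound on the segment `[ωᵢ s + μᵢ, ωᵢ(s+ζ) + μᵢ]`** (the hypothesis of Lemma 5♯
for the `i`-th factor): `≤ 5/(ωᵢ Im s)`, for `|Re s| ≤ C (Im s)^{1/4}`, `|Re ζ|, |Im ζ| ≤ 2(Im s)^{2/3}`
and `Im s` large (from `Literature.Analysis.SpecialFunctions.Complex.norm_digamma_sub_log_le_seg`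
with `b = ωᵢ Im s/2`, `m = ⌈ωᵢ(C (Im s)^{1/4} + 2 (Im s)^{2/3})⌉ + 1`).
[cite: Dobner2021, Lemma 5 (proof, p. 16: Stirling for ψ in the sector)] -/
theorem norm_digamma_sub_log_le_factor (i : Fin D.numGamma) {s ζ : ℂ} {C : ℝ} (hC : 0 ≤ C)
    (hy : 0 < s.im) (hx : |s.re| ≤ C * s.im ^ (1 / 4 : ℝ)) (hP : D.poleHeight ≤ s.im / 4)
    (hζre : |ζ.re| ≤ 2 * s.im ^ (2 / 3 : ℝ)) (hζim : |ζ.im| ≤ 2 * s.im ^ (2 / 3 : ℝ))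
    (hY : 2 * s.im ^ (2 / 3 : ℝ) ≤ s.im / 4)
    (hm : 4 * (D.omega i * (C * s.im ^ (1 / 4 : ℝ) + 2 * s.im ^ (2 / 3 : ℝ)) + 3) ≤ D.omega i * s.im)
    {τ' : ℝ} (hτ' : τ' ∈ Set.Icc (0 : ℝ) 1) :
    ‖Complex.digamma ((D.omega i : ℂ) * s + D.mu i + τ' * ((D.omega i : ℂ) * ζ)) -
        Complex.log ((D.omega i : ℂ) * s + D.mu i + τ' * ((D.omega i : ℂ) * ζ))‖ ≤
      5 / (D.omega i * s.im) := by
  have hω := D.omega_pos i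
  have hpi4 := Real.pi_le_four
  set y : ℝ := s.im with hydef
  set Y : ℝ := y ^ (2 / 3 : ℝ) with hYdef
  set X : ℝ := D.omega i * (C * y ^ (1 / 4 : ℝ) + 2 * Y) with hXdef
  have hX0 : 0 ≤ X := by positivity
  set m : ℕ := ⌈X⌉₊ + 1 with hmdef
  have hm0 : X + 1 ≤ (m : ℝ) := by
    rw [hmdef]; push_cast; linarith [Nat.le_ceil X]
  have hm1 : (m : ℝ) + 1 ≤ X + 3 := by
    rw [hmdef]; push_cast; linarith [Nat.ceil_lt_add_one hX0]
  set b : ℝ := D.omega i * y / 2 with hbdef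
  have hb : 0 < b := by positivity
  -- the endpoints of the segment
  have hw_im : b ≤ ((D.omega i : ℂ) * s + D.mu i).im := by
    have h1 := D.omega_mul_im_sub_le i s
    rw [hbdef]; nlinarith
  have hwd_eq : (D.omega i : ℂ) * s + D.mu i + (D.omega i : ℂ) * ζ =
      (D.omega i : ℂ) * (s + ζ) + D.mu i := by ring
  have hwd_im : b ≤ ((D.omega i : ℂ) * s + D.mu i + (D.omega i : ℂ) * ζ).im := by
    rw [hwd_eq]
    have h1 := D.omega_mul_im_sub_le i (s + ζ)
    have h2 : y / 2 ≤ (s + ζ).im - D.poleHeight := by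
      simp only [Complex.add_im]; rw [← hydef]; linarith [(abs_le.1 hζim).1]
    rw [hbdef]; nlinarith
  have hw_re : 0 < ((D.omega i : ℂ) * s + D.mu i).re + m := by
    have e : ((D.omega i : ℂ) * s + D.mu i).re = D.omega i * s.re + (D.mu i).re := by simp
    rw [e]
    have h1 : -(D.omega i * (C * y ^ (1 / 4 : ℝ))) ≤ D.omega i * s.re := by
      have := (abs_le.1 hx).1; nlinarith
    have h2 : D.omega i * (C * y ^ (1 / 4 : ℝ)) ≤ X := by
      rw [hXdef]; nlinarith [Real.rpow_nonneg hy.le (2 / 3 : ℝ)]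
    linarith [D.mu_re_nonneg i]
  have hwd_re : 0 < ((D.omega i : ℂ) * s + D.mu i + (D.omega i : ℂ) * ζ).re + m := by
    have e : ((D.omega i : ℂ) * s + D.mu i + (D.omega i : ℂ) * ζ).re =
        D.omega i * (s.re + ζ.re) + (D.mu i).re := by simp; ring
    rw [e]
    have h1 : -(D.omega i * (C * y ^ (1 / 4 : ℝ) + 2 * Y)) ≤ D.omega i * (s.re + ζ.re) := by
      have := (abs_le.1 hx).1; have := (abs_le.1 hζre).1; nlinarith
    linarith [D.mu_re_nonneg i]
  have h := Literature.Analysis.SpecialFunctions.Complex.norm_digamma_sub_log_le_seg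
    (w₀ := (D.omega i : ℂ) * s + D.mu i) (d := (D.omega i : ℂ) * ζ) hb hw_im hwd_im hw_re hwd_re hτ'
  refine h.trans ?_
  -- `(π/4+1)/b + (m+1)/b² ≤ 4/(ωy) + 1/(ωy)`
  have hωy : 0 < D.omega i * y := by positivity
  have e1 : (Real.pi / 4 + 1) / b ≤ 4 / (D.omega i * y) := by
    rw [hbdef, div_le_div_iff₀ hb hωy]
    nlinarith
  have e2 : ((m : ℝ) + 1) / b ^ 2 ≤ 1 / (D.omega i * y) := by
    rw [hbdef, div_le_div_iff₀ (by positivity) hωy]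
    have h4 : 4 * ((m : ℝ) + 1) ≤ D.omega i * y := by linarith
    nlinarith
  have e3 : 4 / (D.omega i * y) + 1 / (D.omega i * y) = 5 / (D.omega i * y) := by ring
  linarith

/-- The `i`-th error term of Lemma 5♯ on the segment:
`(5/(ωᵢy))‖ωᵢζ‖ + 2‖ωᵢζ‖³/‖ωᵢ s + μᵢ‖² ≤ 5‖ζ‖/y + 8ωᵢ‖ζ‖³/y²` (`‖ωᵢ s + μᵢ‖ ≥ ωᵢ y/2`).
[cite: Dobner2021, Lemma 5, p. 11] -/
theorem factor_error_le (i : Fin D.numGamma) {s : ℂ} (ζ : ℂ) (hy : 0 < s.im)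
    (hP : 2 * D.poleHeight ≤ s.im) :
    5 / (D.omega i * s.im) * ‖(D.omega i : ℂ) * ζ‖ +
        2 * ‖(D.omega i : ℂ) * ζ‖ ^ 3 / ‖(D.omega i : ℂ) * s + D.mu i‖ ^ 2 ≤
      5 * ‖ζ‖ / s.im + 8 * D.omega i * ‖ζ‖ ^ 3 / s.im ^ 2 := by
  have hω := D.omega_pos i
  rw [D.norm_omega_mul]
  have hw := D.norm_omega_mul_add_mu_ge i hP
  have hw0 : 0 < ‖(D.omega i : ℂ) * s + D.mu i‖ := lt_of_lt_of_le (by positivity) hw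
  have e1 : 5 / (D.omega i * s.im) * (D.omega i * ‖ζ‖) = 5 * ‖ζ‖ / s.im := by
    field_simp
  have e2 : 2 * (D.omega i * ‖ζ‖) ^ 3 / ‖(D.omega i : ℂ) * s + D.mu i‖ ^ 2 ≤
      8 * D.omega i * ‖ζ‖ ^ 3 / s.im ^ 2 := by
    rw [div_le_div_iff₀ (by positivity) (by positivity)]
    have hζ := norm_nonneg ζ
    have h3 : 0 ≤ D.omega i * ‖ζ‖ ^ 3 := by positivity
    have hsq : (D.omega i * s.im / 2) ^ 2 ≤ ‖(D.omega i : ℂ) * s + D.mu i‖ ^ 2 :=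
      pow_le_pow_left₀ (by positivity) hw 2
    nlinarith
  linarith

/-- Summing the factor errors: `∑ᵢ (5‖ζ‖/y + 8ωᵢ‖ζ‖³/y²) = 5k‖ζ‖/y + 8W‖ζ‖³/y²`. [folklore] -/
private theorem sum_factor_error_eq (s ζ : ℂ) :
    ∑ i : Fin D.numGamma, (5 * ‖ζ‖ / s.im + 8 * D.omega i * ‖ζ‖ ^ 3 / s.im ^ 2) =
      5 * D.numGamma * ‖ζ‖ / s.im + 8 * D.omegaSum * ‖ζ‖ ^ 3 / s.im ^ 2 := by
  rw [Finset.sum_add_distrib, Finset.sum_const, Finset.card_univ, Fintype.card_fin, nsmul_eq_mul,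
    omegaSum]
  have e : ∑ i : Fin D.numGamma, 8 * D.omega i * ‖ζ‖ ^ 3 / s.im ^ 2 =
      (∑ i : Fin D.numGamma, D.omega i) * (8 * ‖ζ‖ ^ 3 / s.im ^ 2) := by
    rw [Finset.sum_mul]
    refine Finset.sum_congr rfl fun i _ ↦ ?_
    ring
  rw [e]
  ring

/-! ## The pointwise relative error on the segment `M` -/

set_option maxHeartbeats 1600000 in
/-- **Relative error on `M`** ([Dobner2021, (4.4)–(4.5)] for `F ∈ 𝒮♯`): for `u ∈ [−Y, Y]`,
`Y = y^{2/3}`, `‖𝓘(c + iu) − main_A e^{−Au²}‖ ≤ ‖main_A‖ · K₁ (1+|u|³) y^{−1/5} · e^{−(Re A) u²}`,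
`main_A = γ_t(s) n^{−s} e^{−log² n/(4A)}`, with the explicit constant
`K₁ = e^{2k + 64W} (8·2ᵐ + 20k + 64W)` (`k = numGamma`, `W = ∑ωᵢ`, `m = polarOrder`), under explicit
largeness conditions on `y = Im s`. Port of the `ζ`-case
`Literature.NumberTheory.LFunctions.dobner_segment_bound` with Lemma 5 applied to every factor.
[cite: Dobner2021, proof of Lemma 4, eq. (4.5), p. 12] -/
theorem dobner_segment_bound {t : ℝ} (ht : t ≠ 0) {n : ℕ} (hn : 1 ≤ n) {s : ℂ} {C u : ℝ}
    (hy16 : 16 ≤ s.im) (hP : 4 * D.poleHeight ≤ s.im)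
    (hx : |s.re| ≤ C * s.im ^ (1 / 4 : ℝ)) (hC : 0 ≤ C) (hτW : 2 * |t| * D.omegaSum ≤ s.im)
    (hY : 2 * s.im ^ (2 / 3 : ℝ) ≤ s.im / 4) (h35 : s.im ^ (3 / 5 : ℝ) ≤ s.im ^ (2 / 3 : ℝ))
    (hm : ∀ i, 4 * (D.omega i * (C * s.im ^ (1 / 4 : ℝ) + 2 * s.im ^ (2 / 3 : ℝ)) + 3) ≤
      D.omega i * s.im)
    (hℓ : Real.log n ≤ s.im ^ (3 / 5 : ℝ) / |t|)
    (hu : u ∈ Set.Icc (-(s.im ^ (2 / 3 : ℝ))) (s.im ^ (2 / 3 : ℝ))) :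
    ‖D.dobnerI t n s (D.dobnerCenter t n s + u * I) -
        (D.dobnerGammaT t s * (n : ℂ) ^ (-s) *
          Complex.exp (-((Real.log n : ℂ) ^ 2 / (4 * D.dobnerA t s)))) *
          Complex.exp (-D.dobnerA t s * (u : ℂ) ^ 2)‖ ≤
      ‖D.dobnerGammaT t s * (n : ℂ) ^ (-s) *
          Complex.exp (-((Real.log n : ℂ) ^ 2 / (4 * D.dobnerA t s)))‖ *
        ((Real.exp (2 * D.numGamma + 64 * D.omegaSum) *
            (8 * 2 ^ D.polarOrder + 20 * D.numGamma + 64 * D.omegaSum)) *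
          (1 + |u| ^ 3) * s.im ^ (-(1 / 5 : ℝ))) *
        Real.exp (-((D.dobnerA t s).re * u ^ 2)) := by
  have ht' : 0 < |t| := abs_pos.2 ht
  set y : ℝ := s.im with hydef
  set x : ℝ := s.re with hxdef
  set ℓ : ℝ := Real.log n with hℓdef
  set A : ℂ := D.dobnerA t s with hAdef
  set lam : ℂ := D.dobnerShift t n s with hlam
  set Y : ℝ := y ^ (2 / 3 : ℝ) with hYdef
  set q : ℝ := y ^ (3 / 5 : ℝ) with hqdef
  set ζ : ℂ := lam + u * I with hζdef
  set k : ℕ := D.numGamma with hkdef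
  set W : ℝ := D.omegaSum with hWdef
  set E₀ : ℝ := 2 * k + 64 * W with hE₀
  set K₀ : ℝ := 8 * 2 ^ D.polarOrder + 20 * k + 64 * W with hK₀
  set mainA : ℂ := D.dobnerGammaT t s * (n : ℂ) ^ (-s) * Complex.exp (-((ℓ : ℂ) ^ 2 / (4 * A)))
    with hmainA
  have hW0 : 0 ≤ W := D.omegaSum_nonneg
  have hy0 : 0 < y := by linarith
  have hy1 : 1 ≤ y := by linarith
  have hq0 : 0 ≤ q := Real.rpow_nonneg hy0.le _
  have hY0 : 0 ≤ Y := Real.rpow_nonneg hy0.le _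
  have hℓ0 : 0 ≤ ℓ := Real.log_natCast_nonneg n
  have hP0 := D.poleHeight_nonneg
  have hs2P : 2 * D.poleHeight ≤ y := by linarith
  have hsP : D.poleHeight < y := by linarith
  have hs0 : s ≠ 0 := fun h ↦ by rw [h] at hydef; simp at hydef; linarith
  have hs1 : s - 1 ≠ 0 := fun h ↦ by
    have := congrArg Complex.im h; simp at this; linarith
  have hA0 : A ≠ 0 := D.dobnerA_ne_zero ht hy0 hs2P hτW
  -- the point `c + iu = s + ζ`
  have hcz : D.dobnerCenter t n s + u * I = s + ζ := by
    rw [dobnerCenter, hζdef, hlam]; ring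
  -- sizes
  have huY : |u| ≤ Y := abs_le.2 hu
  have hlam1 : ‖lam‖ ≤ q := by
    have h1 := D.norm_dobnerShift_le ht hy0 hs2P hτW hn
    rw [← hlam, ← hℓdef] at h1
    calc ‖lam‖ ≤ |t| * ℓ := h1
      _ ≤ |t| * (q / |t|) := mul_le_mul_of_nonneg_left hℓ ht'.le
      _ = q := by field_simp
  have hζ1 : ‖ζ‖ ≤ |u| + q := by
    calc ‖ζ‖ ≤ ‖lam‖ + ‖(u : ℂ) * I‖ := norm_add_le _ _
      _ = ‖lam‖ + |u| := by rw [norm_mul, Complex.norm_I, mul_one, Complex.norm_real, Real.norm_eq_abs]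
      _ ≤ |u| + q := by linarith
  have hζ2 : ‖ζ‖ ≤ 2 * Y := by linarith
  have hζy : ‖ζ‖ ≤ y / 4 := by linarith
  have hns : y ≤ ‖s‖ := by
    have := Complex.abs_im_le_norm s; rwa [← hydef, abs_of_pos hy0] at this
  have hs2 : 2 ≤ ‖s‖ := by linarith
  have hζs : ‖ζ‖ ≤ ‖s‖ / 2 := by linarith
  have hζim : |ζ.im| ≤ 2 * Y := (Complex.abs_im_le_norm ζ).trans hζ2
  have hζre : |ζ.re| ≤ 2 * Y := (Complex.abs_re_le_norm ζ).trans hζ2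
  have hsζ : D.poleHeight < (s + ζ).im := by
    simp only [Complex.add_im]; rw [← hydef]; linarith [(abs_le.1 hζim).1]
  -- the hypotheses of Lemma 5♯
  have hd : ∀ i, ‖(D.omega i : ℂ) * ζ‖ ≤ ‖(D.omega i : ℂ) * s + D.mu i‖ / 2 := by
    intro i
    rw [D.norm_omega_mul]
    have h1 := D.norm_omega_mul_add_mu_ge i hs2P
    rw [← hydef] at h1
    have hω := D.omega_pos i
    nlinarith
  have hψ : ∀ i, ∀ τ' ∈ Set.Icc (0 : ℝ) 1,
      ‖Complex.digamma ((D.omega i : ℂ) * s + D.mu i + τ' * ((D.omega i : ℂ) * ζ)) -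
        Complex.log ((D.omega i : ℂ) * s + D.mu i + τ' * ((D.omega i : ℂ) * ζ))‖ ≤
          (fun i ↦ 5 / (D.omega i * y)) i := by
    intro i τ' hτ'
    exact D.norm_digamma_sub_log_le_factor i hC hy0 hx (by linarith) hζre hζim hY (hm i) hτ'
  -- the factorisation
  obtain ⟨E, hE, hfact⟩ := D.dobnerI_center_eq ht hn hsP hsζ hd hψ
  rw [← hAdef, ← hℓdef] at hfact
  -- `‖E‖ ≤ 5k‖ζ‖/y + 8W‖ζ‖³/y²` and `‖E‖ ≤ E₀`
  have hE1 : ‖E‖ ≤ 5 * k * ‖ζ‖ / y + 8 * W * ‖ζ‖ ^ 3 / y ^ 2 := by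
    refine hE.trans ?_
    rw [hkdef, hWdef, hydef, ← D.sum_factor_error_eq s ζ]
    exact Finset.sum_le_sum fun i _ ↦ D.factor_error_le i ζ hy0 hs2P
  have hY3 : Y ^ 3 = y ^ 2 := by
    rw [hYdef, ← Real.rpow_natCast, ← Real.rpow_mul hy0.le]; norm_num
  have hk0 : (0 : ℝ) ≤ k := Nat.cast_nonneg _
  have hE0le : ‖E‖ ≤ E₀ := by
    have h1 : 5 * k * ‖ζ‖ / y ≤ 2 * k := by
      rw [div_le_iff₀ hy0]
      have := mul_le_mul_of_nonneg_left hζy (by positivity : (0 : ℝ) ≤ 5 * k)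
      nlinarith
    have h2 : 8 * W * ‖ζ‖ ^ 3 / y ^ 2 ≤ 64 * W := by
      rw [div_le_iff₀ (by positivity)]
      have h3 : ‖ζ‖ ^ 3 ≤ (2 * Y) ^ 3 := pow_le_pow_left₀ (norm_nonneg _) hζ2 3
      have h4 : (2 * Y) ^ 3 = 8 * y ^ 2 := by rw [mul_pow, hY3]; norm_num
      rw [h4] at h3
      have := mul_le_mul_of_nonneg_left h3 (by positivity : (0 : ℝ) ≤ 8 * W)
      nlinarith
    rw [hE₀]; linarith
  -- `‖P − 1‖ ≤ 4‖ζ‖/‖s‖ ≤ 1`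
  have hP1 := norm_poly_ratio_sub_one_le hs2 hζs hs0 hs1
  have hρ1 : 4 * ‖ζ‖ / ‖s‖ ≤ 1 := by
    rw [div_le_one (by linarith)]; linarith
  have hQ := norm_pow_mul_cexp_sub_one_le (E := E) (hP1.trans hρ1) D.polarOrder
  -- numerics: `2ᵐ‖P−1‖ + 2‖E‖ ≤ K₀ (1+|u|³) y^{-1/5}`
  set w : ℝ := y ^ (-(1 / 5 : ℝ)) with hwdef
  have hw0 : 0 < w := Real.rpow_pos_of_pos hy0 _
  set U : ℝ := |u| with hUdef
  have hU0 : 0 ≤ U := abs_nonneg u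
  have hnum : 2 ^ D.polarOrder * ‖(s + ζ) * (s + ζ - 1) / (s * (s - 1)) - 1‖ + 2 * ‖E‖ ≤
      K₀ * (1 + U ^ 3) * w := by
    have i1 : 1 / y ≤ w := by
      rw [hwdef, one_div, ← Real.rpow_neg_one]
      exact Real.rpow_le_rpow_of_exponent_le hy1 (by norm_num)
    have i2 : 1 / y ^ 2 ≤ w := by
      have : 1 / y ^ 2 ≤ 1 / y := by
        rw [div_le_div_iff₀ (by positivity) hy0]
        have h := mul_le_mul_of_nonneg_left hy1 hy0.le
        linarith only [h]
      exact this.trans i1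
    have i3 : q / y ≤ w := by
      rw [hqdef, hwdef, div_eq_mul_inv, ← Real.rpow_neg_one, ← Real.rpow_add hy0]
      exact Real.rpow_le_rpow_of_exponent_le hy1 (by norm_num)
    have i4 : q ^ 3 / y ^ 2 = w := by
      have e1 : q ^ 3 = y ^ (9 / 5 : ℝ) := by
        rw [hqdef, ← Real.rpow_natCast _ 3, ← Real.rpow_mul hy0.le]; norm_num
      have e2 : y ^ 2 = y ^ (2 : ℝ) := (Real.rpow_two y).symm
      rw [e1, e2, hwdef, ← Real.rpow_sub hy0]; norm_num
    have hU1 : U ≤ 1 + U ^ 3 := by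
      rcases le_or_gt U 1 with h | h
      · linarith [pow_nonneg hU0 3]
      · have h2 : U * 1 ≤ U * U ^ 2 :=
          mul_le_mul_of_nonneg_left (one_le_pow₀ h.le) hU0
        have h3 : U * U ^ 2 = U ^ 3 := by ring
        linarith
    have hU3 : 0 ≤ U ^ 3 := pow_nonneg hU0 3
    -- `(U+q)/y ≤ 2(1+U³)w`, `(U³+q³)/y² ≤ (1+U³)w`
    have k1 : (U + q) / y ≤ 2 * (1 + U ^ 3) * w := by
      have e : (U + q) / y = U * (1 / y) + q / y := by ring
      rw [e]
      have : U * (1 / y) ≤ (1 + U ^ 3) * w := mul_le_mul hU1 i1 (by positivity) (by positivity)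
      nlinarith
    have k2 : (U ^ 3 + q ^ 3) / y ^ 2 ≤ (1 + U ^ 3) * w := by
      have e : (U ^ 3 + q ^ 3) / y ^ 2 = U ^ 3 * (1 / y ^ 2) + q ^ 3 / y ^ 2 := by ring
      rw [e, i4]
      have : U ^ 3 * (1 / y ^ 2) ≤ U ^ 3 * w := mul_le_mul_of_nonneg_left i2 hU3
      nlinarith
    -- `‖P − 1‖ ≤ 4(U+q)/y`
    have j1 : ‖(s + ζ) * (s + ζ - 1) / (s * (s - 1)) - 1‖ ≤ 4 * ((U + q) / y) := by
      refine hP1.trans ?_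
      rw [mul_div_assoc]
      refine mul_le_mul_of_nonneg_left ?_ (by norm_num)
      rw [div_le_div_iff₀ (by linarith) hy0]
      exact mul_le_mul hζ1 hns hy0.le (by positivity)
    -- `2‖E‖ ≤ 10k(U+q)/y + 64W(U³+q³)/y²`
    have j2 : 2 * ‖E‖ ≤ 10 * k * ((U + q) / y) + 64 * W * ((U ^ 3 + q ^ 3) / y ^ 2) := by
      have h1 : ‖ζ‖ ^ 3 ≤ (U + q) ^ 3 := pow_le_pow_left₀ (norm_nonneg _) hζ1 3
      have h2 : (U + q) ^ 3 ≤ 4 * (U ^ 3 + q ^ 3) := by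
        have key : 0 ≤ (U + q) * (U - q) ^ 2 :=
          mul_nonneg (add_nonneg hU0 hq0) (sq_nonneg (U - q))
        linarith only [key]
      have h3 : 8 * W * ‖ζ‖ ^ 3 / y ^ 2 ≤ 32 * W * ((U ^ 3 + q ^ 3) / y ^ 2) := by
        have h12 := h1.trans h2
        have e : 32 * W * ((U ^ 3 + q ^ 3) / y ^ 2) = 8 * W * (4 * (U ^ 3 + q ^ 3)) / y ^ 2 := by
          ring
        rw [e]
        exact div_le_div_of_nonneg_right (mul_le_mul_of_nonneg_left h12 (by positivity))
          (by positivity)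
      have h4 : 5 * k * ‖ζ‖ / y ≤ 5 * k * ((U + q) / y) := by
        rw [show 5 * k * ‖ζ‖ / y = 5 * k * (‖ζ‖ / y) by ring]
        exact mul_le_mul_of_nonneg_left (div_le_div_of_nonneg_right hζ1 hy0.le) (by positivity)
      linarith
    have hK0w : 0 ≤ (1 + U ^ 3) * w := by positivity
    have h2m : (0 : ℝ) ≤ 2 ^ D.polarOrder := by positivity
    calc 2 ^ D.polarOrder * ‖(s + ζ) * (s + ζ - 1) / (s * (s - 1)) - 1‖ + 2 * ‖E‖
        ≤ 2 ^ D.polarOrder * (4 * ((U + q) / y)) +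
          (10 * k * ((U + q) / y) + 64 * W * ((U ^ 3 + q ^ 3) / y ^ 2)) := by
          gcongr
      _ ≤ 2 ^ D.polarOrder * (4 * (2 * (1 + U ^ 3) * w)) +
          (10 * k * (2 * (1 + U ^ 3) * w) + 64 * W * ((1 + U ^ 3) * w)) := by
          gcongr
      _ = K₀ * (1 + U ^ 3) * w := by rw [hK₀]; ring
  have hQ1 : ‖((s + ζ) * (s + ζ - 1) / (s * (s - 1))) ^ D.polarOrder * Complex.exp E - 1‖ ≤
      Real.exp E₀ * K₀ * (1 + U ^ 3) * w := by
    refine hQ.trans ?_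
    have h1 : Real.exp ‖E‖ ≤ Real.exp E₀ := Real.exp_le_exp.2 hE0le
    have h2 : 0 ≤ 2 ^ D.polarOrder * ‖(s + ζ) * (s + ζ - 1) / (s * (s - 1)) - 1‖ + 2 * ‖E‖ := by
      positivity
    calc Real.exp ‖E‖ * (2 ^ D.polarOrder * ‖(s + ζ) * (s + ζ - 1) / (s * (s - 1)) - 1‖ + 2 * ‖E‖)
        ≤ Real.exp E₀ * (K₀ * (1 + U ^ 3) * w) := mul_le_mul h1 hnum h2 (Real.exp_pos _).le
      _ = _ := by ring
  -- rewrite the integrand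
  have hexp : Complex.exp (A * ζ ^ 2 - (ℓ : ℂ) * ζ) =
      Complex.exp (-((ℓ : ℂ) ^ 2 / (4 * A))) * Complex.exp (-A * (u : ℂ) ^ 2) := by
    rw [← Complex.exp_add, hζdef, hlam, hAdef, hℓdef, D.dobnerA_sq_sub_on_segment hA0 n u, neg_mul]
  have hI : D.dobnerI t n s (D.dobnerCenter t n s + u * I) =
      mainA * Complex.exp (-A * (u : ℂ) ^ 2) *
        (((s + ζ) * (s + ζ - 1) / (s * (s - 1))) ^ D.polarOrder * Complex.exp E) := by
    rw [hcz, hfact, hexp, hmainA]; ring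
  rw [hI]
  have e : mainA * Complex.exp (-A * (u : ℂ) ^ 2) *
        (((s + ζ) * (s + ζ - 1) / (s * (s - 1))) ^ D.polarOrder * Complex.exp E) -
      mainA * Complex.exp (-A * (u : ℂ) ^ 2) =
      mainA * Complex.exp (-A * (u : ℂ) ^ 2) *
        (((s + ζ) * (s + ζ - 1) / (s * (s - 1))) ^ D.polarOrder * Complex.exp E - 1) := by ring
  rw [e, norm_mul, norm_mul, norm_cexp_neg_mul_sq]
  have h0 : 0 ≤ ‖mainA‖ * Real.exp (-A.re * u ^ 2) := by positivity
  calc ‖mainA‖ * Real.exp (-A.re * u ^ 2) *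
        ‖((s + ζ) * (s + ζ - 1) / (s * (s - 1))) ^ D.polarOrder * Complex.exp E - 1‖
      ≤ ‖mainA‖ * Real.exp (-A.re * u ^ 2) * (Real.exp E₀ * K₀ * (1 + U ^ 3) * w) :=
        mul_le_mul_of_nonneg_left hQ1 h0
    _ = _ := by rw [hUdef, hwdef, hE₀, hK₀, neg_mul]; ring


/-! ## Norms of the main terms; a lower bound for `γ_t`; continuity on the segment -/

/-- `‖γ_t(s) e^{−(|t|/4) log² n} n^{−s}‖ = ‖γ_t(s)‖ e^{−(|t|/4) log² n} n^{−Re s}` (`n ≥ 1`).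
[cite: Dobner2021, Lemma 4 (i), p. 10] -/
theorem norm_dobnerMainTerm_eq (t : ℝ) {n : ℕ} (hn : 1 ≤ n) (s : ℂ) :
    ‖D.dobnerMainTerm t n s‖ =
      ‖D.dobnerGammaT t s‖ * Real.exp (-(|t| / 4) * Real.log n ^ 2) * (n : ℝ) ^ (-s.re) := by
  rw [dobnerMainTerm, norm_mul, norm_mul, Complex.norm_exp, Complex.neg_re, Complex.ofReal_re,
    Complex.norm_natCast_cpow_of_pos (by omega), Complex.neg_re]
  congr 2
  ring_nf

/-- **A lower bound for `γ_t` in the region `|Re s| ≤ C (Im s)^{1/4}`** (cf. eq. (4.9), p. 14: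
"`|γ_t(s)| = |γ(s)| |exp((s − J_t(s))²/|t|)| ≫ e^{−K′y}`"): there are `y₀`, `K′ > 0` with
`e^{−K′ Im s} ≤ ‖γ_t(s)‖` for `Im s ≥ y₀`. The `γ`-part is the lower half of Dobner's Lemma 1
(`Literature.NumberTheory.LFunctions.dobner_lemma1_holds`, `θ = 1/4`), the Gaussian part is
`Re((s − J_t(s))²) ≥ −(Im(s − J_t(s)))² = −(|t|²/4)(∑ωᵢ arg(ωᵢ s + μᵢ))² ≥ −|t|²π²W²/4`.
[cite: Dobner2021, §4.1 eq. (4.9), p. 14] -/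
theorem exists_exp_neg_mul_le_norm_dobnerGammaT (hk : 0 < D.numGamma) (t : ℝ) {C : ℝ}
    (hC : 0 < C) :
    ∃ y₀ K' : ℝ, 0 < K' ∧ ∀ s : ℂ, |s.re| ≤ C * s.im ^ (1 / 4 : ℝ) → y₀ ≤ s.im →
      Real.exp (-(K' * s.im)) ≤ ‖D.dobnerGammaT t s‖ := by
  obtain ⟨K, K', T₀, -, hK', hγ⟩ := dobner_lemma1_holds D.alpha D.polarOrder D.Q D.numGamma D.omega
    D.mu D.alpha_ne_zero D.Q_pos hk D.omega_pos D.mu_re_nonneg C (1 / 4) hC (by norm_num)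
    (by norm_num)
  set c : ℝ := |t| * Real.pi ^ 2 * D.omegaSum ^ 2 / 4 with hc
  have hc0 : 0 ≤ c := by positivity
  refine ⟨max T₀ 1, K' + c, by positivity, fun s hx hy ↦ ?_⟩
  have hy1 : 1 ≤ s.im := (le_max_right _ _).trans hy
  have hy0 : 0 < s.im := by linarith
  have hT : T₀ ≤ |s.im| := by rw [abs_of_pos hy0]; exact (le_max_left _ _).trans hy
  have hx' : |s.re| ≤ C * |s.im| ^ (1 / 4 : ℝ) := by rwa [abs_of_pos hy0]
  have h1 := (hγ s hx' hT).1
  rw [abs_of_pos hy0] at h1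
  rw [D.norm_dobnerGammaT]
  -- the Gaussian part
  have h2 : -c ≤ ((s - D.dobnerJ t s) ^ 2).re / |t| := by
    rcases eq_or_ne t 0 with rfl | ht
    · simp [hc]
    have ht' : 0 < |t| := abs_pos.2 ht
    have him : (s - D.dobnerJ t s).im =
        -(|t| / 2 * ∑ i, D.omega i * Complex.arg ((D.omega i : ℂ) * s + D.mu i)) := by
      rw [Complex.sub_im, D.dobnerJ_im]; ring
    have hsum : |∑ i, D.omega i * Complex.arg ((D.omega i : ℂ) * s + D.mu i)| ≤
        Real.pi * D.omegaSum := by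
      refine (Finset.abs_sum_le_sum_abs _ _).trans ?_
      rw [omegaSum, Finset.mul_sum]
      refine Finset.sum_le_sum fun i _ ↦ ?_
      rw [abs_mul, abs_of_pos (D.omega_pos i)]
      have := Complex.abs_arg_le_pi ((D.omega i : ℂ) * s + D.mu i)
      nlinarith [D.omega_pos i]
    have hre : ((s - D.dobnerJ t s) ^ 2).re =
        (s - D.dobnerJ t s).re ^ 2 - (s - D.dobnerJ t s).im ^ 2 := by
      rw [sq, Complex.mul_re]; ring
    rw [hre, le_div_iff₀ ht', him]
    have h3 : (|t| / 2 * ∑ i, D.omega i * Complex.arg ((D.omega i : ℂ) * s + D.mu i)) ^ 2 ≤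
        (|t| / 2 * (Real.pi * D.omegaSum)) ^ 2 := by
      rw [mul_pow, mul_pow]
      refine mul_le_mul_of_nonneg_left ?_ (by positivity)
      exact sq_le_sq' (abs_le.1 hsum).1 (abs_le.1 hsum).2
    have h4 : 0 ≤ (s - D.dobnerJ t s).re ^ 2 := sq_nonneg _
    rw [hc]
    nlinarith
  calc Real.exp (-((K' + c) * s.im)) ≤ Real.exp (-(K' * s.im)) * Real.exp (-c) := by
        rw [← Real.exp_add, Real.exp_le_exp]; nlinarith
    _ ≤ ‖D.gamma s‖ * Real.exp (((s - D.dobnerJ t s) ^ 2).re / |t|) :=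
        mul_le_mul h1 (Real.exp_le_exp.2 h2) (Real.exp_pos _).le (norm_nonneg _)

/-- `u ↦ 𝓘(c + iu)` is continuous on any parameter interval whose image stays above the pole
height. [cite: Dobner2021, §4 p. 11] -/
theorem continuousOn_dobnerI_segment (t : ℝ) {n : ℕ} (hn : 1 ≤ n) (s c : ℂ) {a b : ℝ}
    (h : ∀ u ∈ Set.Icc a b, D.poleHeight < (c + u * I).im) :
    ContinuousOn (fun u : ℝ ↦ D.dobnerI t n s (c + u * I)) (Set.Icc a b) := by
  intro u hu
  have hd := D.differentiableAt_dobnerI t hn s (h u hu)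
  have hl : Continuous fun u : ℝ ↦ c + (u : ℂ) * I := by fun_prop
  exact (ContinuousAt.comp' (f := fun u : ℝ ↦ c + (u : ℂ) * I) hd.continuousAt
    hl.continuousAt).continuousWithinAt


set_option maxHeartbeats 8000000 in
/-- **The saddle-point segment: parts (i)/(ii) of Lemma 4♯ for the truncated steepest-descent
integral** `M = (π|t|)^{−1/2} ∫_{−Y}^{Y} 𝓘(c + iu) du` (`c = s + log n/(2A)`, `Y = (Im s)^{2/3}`) in
place of `B_{t,n}(s)`: for `t < 0`, `C > 0` there are `y₀`, `K > 0` such that for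
`|Re s| ≤ C(Im s)^{1/4}`, `Im s ≥ y₀`, `n ≥ 1`:
(i) `log n ≤ (Im s)^{1/3}/|t| ⟹ ‖M − main‖ ≤ K (Im s)^{−1/5} ‖main‖`;
(ii) `log n ≤ (Im s)^{3/5}/|t| ⟹ ‖M‖ ≤ K ‖γ_t(s)‖ e^{−(|t|/8) log² n} n^{−Re s}` and
`e^{−(Im s)^{4/3}/(18|t|)} ≤ (Im s)^{−1/5} ‖main‖` (absorption of the contour error of the pieces
`V₁, H₁, H₂, V₂`). Port of the `ζ`-case `Literature.NumberTheory.LFunctions.dobner_lemma4_smallmedium`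
minus its contour input (which is the separate file of the rectangle step), with Lemma 5♯
(`dobner_segment_bound`) and the lower bound `exists_exp_neg_mul_le_norm_dobnerGammaT`.
[cite: Dobner2021, proof of Lemma 4 (i),(ii), pp. 11–12 (the M integral, eq. (4.4)–(4.7))] -/
theorem dobner_lemma4_segment (hk : 0 < D.numGamma) {t : ℝ} (ht : t < 0) {C : ℝ} (hC : 0 < C) :
    ∃ y₀ K : ℝ, 0 < K ∧ ∀ s : ℂ, |s.re| ≤ C * s.im ^ (1 / 4 : ℝ) → y₀ ≤ s.im → ∀ n : ℕ, 1 ≤ n →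
      (Real.log n ≤ s.im ^ (1 / 3 : ℝ) / |t| →
        ‖((1 / Real.sqrt (Real.pi * |t|) : ℝ) : ℂ) *
            (∫ u in (-(s.im ^ (2 / 3 : ℝ)))..(s.im ^ (2 / 3 : ℝ)),
              D.dobnerI t n s (D.dobnerCenter t n s + u * I)) - D.dobnerMainTerm t n s‖ ≤
          K * s.im ^ (-(1 / 5 : ℝ)) * ‖D.dobnerMainTerm t n s‖) ∧
      (Real.log n ≤ s.im ^ (3 / 5 : ℝ) / |t| →
        ‖((1 / Real.sqrt (Real.pi * |t|) : ℝ) : ℂ) *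
            (∫ u in (-(s.im ^ (2 / 3 : ℝ)))..(s.im ^ (2 / 3 : ℝ)),
              D.dobnerI t n s (D.dobnerCenter t n s + u * I))‖ ≤
          K * ‖D.dobnerGammaT t s‖ * Real.exp (-(|t| / 8) * Real.log n ^ 2) *
            (n : ℝ) ^ (-s.re) ∧
        Real.exp (-(s.im ^ (4 / 3 : ℝ) / (18 * |t|))) ≤
          s.im ^ (-(1 / 5 : ℝ)) * ‖D.dobnerMainTerm t n s‖) := by
  have ht0 : t ≠ 0 := ht.ne
  have hτ : 0 < |t| := abs_pos.2 ht0
  set τ : ℝ := |t| with hτdef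
  have hpi := Real.pi_gt_three
  have hpi4 := Real.pi_le_four
  set cτ : ℝ := 1 / Real.sqrt (Real.pi * τ) with hcτ
  have hcτ0 : 0 < cτ := by positivity
  set Mτ : ℝ := (2 + 32 * τ ^ 2) * Real.sqrt (4 * Real.pi * τ) with hMτ
  have hMτ0 : 0 ≤ Mτ := by positivity
  set Sτ : ℝ := Real.sqrt (4 * Real.pi * τ) with hSτ
  have hSτ0 : 0 < Sτ := by positivity
  set W₀ : ℝ := D.omegaSum with hW₀def
  have hW₀ : 0 ≤ W₀ := D.omegaSum_nonneg
  set K₁ : ℝ := Real.exp (2 * D.numGamma + 64 * W₀) *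
    (8 * 2 ^ D.polarOrder + 20 * D.numGamma + 64 * W₀) with hK₁
  have hK₁0 : 0 ≤ K₁ := by positivity
  -- the constant
  set K : ℝ := 4 + 2 * cτ * (K₁ * Mτ + Sτ + 1) with hKdef
  have hK0 : 0 < K := by positivity
  -- input: the lower bound for `γ_t`
  obtain ⟨y₂, K', hK', hy₂⟩ := D.exists_exp_neg_mul_le_norm_dobnerGammaT hk t hC
  -- largeness conditions
  have evA : ∀ᶠ y : ℝ in atTop, y₂ ≤ y ∧ 16 ≤ y ∧ 4 * D.poleHeight ≤ y ∧ 10 * τ * W₀ ≤ y := by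
    filter_upwards [eventually_ge_atTop y₂, eventually_ge_atTop (16 : ℝ),
      eventually_ge_atTop (4 * D.poleHeight), eventually_ge_atTop (10 * τ * W₀)] with y h1 h2 h3 h4
    exact ⟨h1, h2, h3, h4⟩
  have evB : ∀ᶠ y : ℝ in atTop, 2 * y ^ (2 / 3 : ℝ) ≤ y / 4 ∧ y ^ (3 / 5 : ℝ) ≤ y ^ (2 / 3 : ℝ) ∧
      2 * τ * W₀ ≤ y ^ (4 / 5 : ℝ) ∧ 4 * W₀ * y ^ (2 / 3 : ℝ) ≤ y ^ (4 / 5 : ℝ) := by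
    filter_upwards [eventually_const_mul_rpow_le_rpow 8 (by norm_num : (2 / 3 : ℝ) < 1),
      eventually_const_mul_rpow_le_rpow 1 (by norm_num : (3 / 5 : ℝ) < 2 / 3),
      eventually_const_le_rpow (2 * τ * W₀) (by norm_num : (0 : ℝ) < 4 / 5),
      eventually_const_mul_rpow_le_rpow (4 * W₀) (by norm_num : (2 / 3 : ℝ) < 4 / 5)]
      with y h1 h2 h3 h4
    rw [Real.rpow_one] at h1
    rw [one_mul] at h2
    exact ⟨by linarith, h2, h3, h4⟩
  have evM : ∀ᶠ y : ℝ in atTop, ∀ i, 4 * (D.omega i * (C * y ^ (1 / 4 : ℝ) + 2 * y ^ (2 / 3 : ℝ)) + 3) ≤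
      D.omega i * y := by
    refine Filter.eventually_all.2 fun i ↦ ?_
    have hω := D.omega_pos i
    filter_upwards [eventually_const_mul_rpow_le_rpow (3 * (4 * C)) (by norm_num : (1 / 4 : ℝ) < 1),
      eventually_const_mul_rpow_le_rpow (3 * 8) (by norm_num : (2 / 3 : ℝ) < 1),
      eventually_ge_atTop (36 / D.omega i)] with y h1 h2 h3
    rw [Real.rpow_one] at h1 h2
    have h3' : 36 ≤ D.omega i * y := by rwa [div_le_iff₀' hω] at h3
    have e1 : 0 ≤ D.omega i * (y - 12 * C * y ^ (1 / 4 : ℝ)) := mul_nonneg hω.le (by linarith)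
    have e2 : 0 ≤ D.omega i * (y - 24 * y ^ (2 / 3 : ℝ)) := mul_nonneg hω.le (by linarith)
    nlinarith
  have evC : ∀ᶠ y : ℝ in atTop,
      (1 / 5 * Real.log y + K' * y + C * y ^ (17 / 20 : ℝ) / τ +
        y ^ (6 / 5 : ℝ) / (4 * τ) ≤ y ^ (4 / 3 : ℝ) / (18 * τ)) ∧
      (Real.log Sτ + 1 / 5 * Real.log y ≤ y ^ (4 / 3 : ℝ) / (4 * τ)) := by
    filter_upwards [eventually_const_mul_log_le_rpow (90 * τ * (1 / 5)) (by norm_num : (0 : ℝ) < 4 / 3),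
      eventually_const_mul_rpow_le_rpow (90 * τ * K') (by norm_num : (1 : ℝ) < 4 / 3),
      eventually_const_mul_rpow_le_rpow (90 * C) (by norm_num : (17 / 20 : ℝ) < 4 / 3),
      eventually_const_mul_rpow_le_rpow (90 / 4) (by norm_num : (6 / 5 : ℝ) < 4 / 3),
      eventually_const_le_rpow (8 * τ * Real.log Sτ) (by norm_num : (0 : ℝ) < 4 / 3),
      eventually_const_mul_log_le_rpow (8 * τ * (1 / 5)) (by norm_num : (0 : ℝ) < 4 / 3)]
      with y h1 h2 h3 h4 h6 h7
    rw [Real.rpow_one] at h2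
    constructor
    · rw [le_div_iff₀ (by positivity)]
      have e : (1 / 5 * Real.log y + K' * y + C * y ^ (17 / 20 : ℝ) / τ +
          y ^ (6 / 5 : ℝ) / (4 * τ)) * (18 * τ) =
          18 * τ * (1 / 5) * Real.log y + 18 * τ * K' * y +
            18 * C * y ^ (17 / 20 : ℝ) + 18 / 4 * y ^ (6 / 5 : ℝ) := by
        field_simp
      rw [e]; linarith
    · rw [le_div_iff₀ (by positivity)]; linarith
  obtain ⟨y₀, hy₀⟩ := eventually_atTop.1 ((evA.and evB).and (evM.and evC))
  refine ⟨y₀, K, hK0, fun s hx hy n hn ↦ ?_⟩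
  obtain ⟨⟨⟨hyy₂, hy16, hP4, h10τW⟩, ⟨hY4, h3523, hτ45, hW45⟩⟩, hmall, habs, htailc⟩ := hy₀ s.im hy
  clear hy₀ evA evB evM evC
  -- notation
  set y : ℝ := s.im with hydef
  set x : ℝ := s.re with hxdef
  set ℓ : ℝ := Real.log n with hℓdef
  set A : ℂ := D.dobnerA t s with hAdef
  set η : ℂ := ((τ : ℝ) : ℂ) * A - 1 with hηdef
  set c : ℂ := D.dobnerCenter t n s with hcdef
  set Y : ℝ := y ^ (2 / 3 : ℝ) with hYdef
  set q : ℝ := y ^ (3 / 5 : ℝ) with hqdef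
  set mainA : ℂ := D.dobnerGammaT t s * (n : ℂ) ^ (-s) * Complex.exp (-((ℓ : ℂ) ^ 2 / (4 * A)))
    with hmainA
  set main : ℂ := D.dobnerMainTerm t n s with hmain
  set Pg : ℂ := ((Real.pi : ℂ) / A) ^ (1 / 2 : ℂ) with hPg
  set g : ℂ := ((cτ : ℝ) : ℂ) * Pg with hgdef
  set W : ℝ := ‖D.dobnerGammaT t s‖ * Real.exp (-(τ / 8) * ℓ ^ 2) * (n : ℝ) ^ (-x) with hWdef
  set W' : ℝ := ‖D.dobnerGammaT t s‖ * Real.exp (-(τ / 4) * ℓ ^ 2) * (n : ℝ) ^ (-x) with hW'def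
  set tail : ℝ := Real.exp (-(A.re * Y ^ 2 / 2)) * Real.sqrt (2 * Real.pi / A.re) with htail
  set Δ : ℝ := Real.exp (-(y ^ (4 / 3 : ℝ) / (18 * τ))) with hΔ
  set w : ℝ := y ^ (-(1 / 5 : ℝ)) with hwdef
  set MI : ℂ := ∫ u in (-Y)..Y, D.dobnerI t n s (c + u * I) with hMI
  have hy0 : 0 < y := by linarith
  have hy1 : 1 ≤ y := by linarith
  have hY0 : 0 ≤ Y := Real.rpow_nonneg hy0.le _
  have hq0 : 0 ≤ q := Real.rpow_nonneg hy0.le _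
  have hℓ0 : 0 ≤ ℓ := Real.log_natCast_nonneg n
  have hn0 : (0 : ℝ) < n := by exact_mod_cast hn
  have hs0 : s ≠ 0 := fun h ↦ by rw [h] at hydef; simp at hydef; linarith
  have hP0 := D.poleHeight_nonneg
  have hs2P : 2 * D.poleHeight ≤ y := by linarith
  have hτW : 2 * τ * W₀ ≤ y := by nlinarith
  have hw0 : 0 < w := Real.rpow_pos_of_pos hy0 _
  have hw1 : w ≤ 1 := Real.rpow_le_one_of_one_le_of_nonpos hy1 (by norm_num)
  have hWn : 0 ≤ W := by rw [hWdef]; positivity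
  have hW'n : 0 ≤ W' := by rw [hW'def]; positivity
  have hwy : w * y = y ^ (4 / 5 : ℝ) := by
    rw [hwdef, ← Real.rpow_add_one hy0.ne']; norm_num
  -- `η`
  have hAη : ((τ : ℝ) : ℂ) * A = 1 + η := by rw [hηdef]; ring
  have hη : ‖η‖ ≤ τ * W₀ / y := by
    have e : η = ((τ : ℝ) : ℂ) * (A - ((1 / |t| : ℝ) : ℂ)) := by
      have h0 : ((|t| : ℝ) : ℂ) ≠ 0 := by exact_mod_cast hτ.ne'
      rw [hηdef, hτdef]; push_cast; field_simp
    rw [e, norm_mul, Complex.norm_real, Real.norm_eq_abs, abs_of_pos hτ]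
    have h1 := D.norm_dobnerA_sub_le t hy0 hs2P
    rw [← hAdef, ← hW₀def, ← hydef] at h1
    calc τ * ‖A - ((1 / |t| : ℝ) : ℂ)‖ ≤ τ * (W₀ / y) := mul_le_mul_of_nonneg_left h1 hτ.le
      _ = τ * W₀ / y := by ring
  have hη10 : ‖η‖ ≤ 1 / 10 := by
    refine hη.trans ?_
    rw [div_le_div_iff₀ hy0 (by norm_num)]; linarith
  have hη2 : ‖η‖ ≤ 1 / 2 := by linarith
  have hηw : 2 * ‖η‖ ≤ w := by
    have e : w = y ^ (4 / 5 : ℝ) / y := by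
      rw [← hwy]; field_simp
    rw [e, le_div_iff₀ hy0]
    calc 2 * ‖η‖ * y ≤ 2 * (τ * W₀ / y) * y := by gcongr
      _ = 2 * τ * W₀ := by field_simp
      _ ≤ y ^ (4 / 5 : ℝ) := hτ45
  have hAre : 1 / (2 * τ) ≤ A.re := D.dobnerA_re_ge ht0 hy0 hs2P hτW
  have hApos : 0 < A.re := lt_of_lt_of_le (by positivity) hAre
  have hg1 : ‖g - 1‖ ≤ 2 * ‖η‖ := norm_gaussConst_sub_one_le ht0 hAη hη2
  have hg2 : ‖g‖ ≤ 2 := by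
    calc ‖g‖ = ‖(g - 1) + 1‖ := by rw [sub_add_cancel]
      _ ≤ ‖g - 1‖ + ‖(1 : ℂ)‖ := norm_add_le _ _
      _ ≤ 2 * ‖η‖ + 1 := by rw [norm_one]; linarith
      _ ≤ 2 := by linarith
  -- norms of `main_A`, `main`
  have hWle : ‖mainA‖ ≤ W := by
    rw [hmainA, norm_mul, norm_mul, Complex.norm_natCast_cpow_of_pos (by omega), Complex.neg_re,
      ← hxdef, hWdef]
    have h1 := norm_cexp_neg_log_sq_div_le ht0 hAη hη10 ℓ
    rw [← hτdef] at h1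
    calc ‖D.dobnerGammaT t s‖ * (n : ℝ) ^ (-x) * ‖Complex.exp (-((ℓ : ℂ) ^ 2 / (4 * A)))‖
        ≤ ‖D.dobnerGammaT t s‖ * (n : ℝ) ^ (-x) * Real.exp (-(τ / 8) * ℓ ^ 2) := by gcongr
      _ = _ := by ring
  have hmain_norm : ‖main‖ = W' := by
    rw [hmain, D.norm_dobnerMainTerm_eq t hn s, hW'def, ← hℓdef, ← hxdef, ← hτdef]
  have hW'W : W' ≤ W := by
    rw [hWdef, hW'def]
    have hτℓ : 0 ≤ τ * ℓ ^ 2 := by positivity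
    have : Real.exp (-(τ / 4) * ℓ ^ 2) ≤ Real.exp (-(τ / 8) * ℓ ^ 2) :=
      Real.exp_le_exp.2 (by linarith only [hτℓ])
    have h0 : 0 ≤ (n : ℝ) ^ (-x) := Real.rpow_nonneg n.cast_nonneg _
    gcongr
  have htailS : tail ≤ Real.exp (-(y ^ (4 / 3 : ℝ) / (4 * τ))) * Sτ := by
    have h1 : Real.exp (-(A.re * Y ^ 2 / 2)) ≤ Real.exp (-(y ^ (4 / 3 : ℝ) / (4 * τ))) := by
      rw [Real.exp_le_exp]
      have e : Y ^ 2 = y ^ (4 / 3 : ℝ) := by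
        rw [hYdef, ← Real.rpow_natCast _ 2, ← Real.rpow_mul hy0.le]; norm_num
      rw [← e]
      have : 1 / (2 * τ) * Y ^ 2 / 2 ≤ A.re * Y ^ 2 / 2 := by gcongr
      have e2 : 1 / (2 * τ) * Y ^ 2 / 2 = Y ^ 2 / (4 * τ) := by field_simp; ring
      linarith
    have h2 : Real.sqrt (2 * Real.pi / A.re) ≤ Sτ := by
      rw [hSτ]
      refine Real.sqrt_le_sqrt ?_
      rw [div_le_iff₀ hApos]
      calc 2 * Real.pi = 4 * Real.pi * τ * (1 / (2 * τ)) := by field_simp; ring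
        _ ≤ 4 * Real.pi * τ * A.re := by gcongr
    rw [htail]; exact mul_le_mul h1 h2 (Real.sqrt_nonneg _) (Real.exp_pos _).le
  have htail1 : tail ≤ w := by
    refine htailS.trans ?_
    rw [hwdef, Real.rpow_def_of_pos hy0 (-(1 / 5 : ℝ)),
      show Sτ = Real.exp (Real.log Sτ) by rw [Real.exp_log hSτ0], ← Real.exp_add, Real.exp_le_exp]
    linarith
  have htail2 : tail ≤ Sτ := by
    refine htailS.trans ?_
    have : Real.exp (-(y ^ (4 / 3 : ℝ) / (4 * τ))) ≤ 1 := by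
      rw [Real.exp_le_one_iff]
      have : 0 ≤ y ^ (4 / 3 : ℝ) / (4 * τ) := by positivity
      linarith
    calc Real.exp (-(y ^ (4 / 3 : ℝ) / (4 * τ))) * Sτ ≤ 1 * Sτ :=
          mul_le_mul_of_nonneg_right this hSτ0.le
      _ = Sτ := one_mul _
  -- core estimate in the regime `log n ≤ y^{3/5}/τ`
  have core : ℓ ≤ q / τ →
      ‖((cτ : ℝ) : ℂ) * MI - mainA * g‖ ≤ cτ * (‖mainA‖ * (K₁ * w * Mτ + tail)) ∧ Δ ≤ w * W' := by
    intro hreg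
    -- the segment
    have hlam1 : ‖D.dobnerShift t n s‖ ≤ q := by
      have h1 := D.norm_dobnerShift_le ht0 hy0 hs2P hτW hn
      calc ‖D.dobnerShift t n s‖ ≤ τ * ℓ := h1
        _ ≤ τ * (q / τ) := mul_le_mul_of_nonneg_left hreg hτ.le
        _ = q := by field_simp
    have hcim : y - q ≤ c.im := by
      rw [hcdef, dobnerCenter, Complex.add_im, ← hydef]
      linarith [(abs_le.1 ((Complex.abs_im_le_norm _).trans hlam1)).1]
    have hseg : ∀ u ∈ Set.Icc (-Y) Y,
        ‖D.dobnerI t n s (c + u * I) - mainA * Complex.exp (-A * (u : ℂ) ^ 2)‖ ≤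
          ‖mainA‖ * (K₁ * (1 + |u| ^ 3) * w) * Real.exp (-(A.re * u ^ 2)) := by
      intro u hu
      exact D.dobner_segment_bound ht0 hn (s := s) (C := C) (u := u) hy16 hP4 hx hC.le hτW hY4 h3523
        hmall hreg hu
    have hFi : IntervalIntegrable (fun u : ℝ ↦ D.dobnerI t n s (c + u * I)) volume (-Y) Y := by
      refine (D.continuousOn_dobnerI_segment t hn s c fun u hu ↦ ?_).intervalIntegrable_of_Icc
        (by linarith)
      have e : (c + u * I).im = c.im + u := by simp
      rw [e]
      have := hu.1
      linarith
    have hM := dobner_M_estimate ht0 (F := fun u : ℝ ↦ D.dobnerI t n s (c + u * I)) (A := A)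
      (mainA := mainA) hY0 hK₁0 hy0 hAre hFi hseg
    rw [← hτdef, ← hMτ, ← htail, ← hPg] at hM
    constructor
    · have e : ((cτ : ℝ) : ℂ) * MI - mainA * g = ((cτ : ℝ) : ℂ) * (MI - mainA * Pg) := by
        rw [hgdef]; ring
      rw [e, norm_mul, Complex.norm_real, Real.norm_eq_abs, abs_of_pos hcτ0]
      exact mul_le_mul_of_nonneg_left hM hcτ0.le
    · -- absorption of `Δ`
      have hγ := hy₂ s hx hyy₂
      rw [← hydef] at hγ
      have h2 : Real.exp (-(y ^ (6 / 5 : ℝ) / (4 * τ))) ≤ Real.exp (-(τ / 4) * ℓ ^ 2) := by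
        rw [Real.exp_le_exp]
        have hℓq : ℓ ^ 2 ≤ (q / τ) ^ 2 := pow_le_pow_left₀ hℓ0 hreg 2
        have e : y ^ (6 / 5 : ℝ) = q ^ 2 := by
          rw [hqdef, ← Real.rpow_natCast _ 2, ← Real.rpow_mul hy0.le]; norm_num
        rw [e]
        have : τ / 4 * ℓ ^ 2 ≤ τ / 4 * (q / τ) ^ 2 := mul_le_mul_of_nonneg_left hℓq (by positivity)
        have e2 : τ / 4 * (q / τ) ^ 2 = q ^ 2 / (4 * τ) := by field_simp
        linarith
      have h3 : Real.exp (-(C * y ^ (17 / 20 : ℝ) / τ)) ≤ (n : ℝ) ^ (-x) := by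
        rw [Real.rpow_def_of_pos hn0, ← hℓdef, Real.exp_le_exp]
        have e : y ^ (17 / 20 : ℝ) = y ^ (1 / 4 : ℝ) * q := by
          rw [hqdef, ← Real.rpow_add hy0]; norm_num
        rw [e]
        have hxℓ : x * ℓ ≤ |x| * ℓ := mul_le_mul_of_nonneg_right (le_abs_self x) hℓ0
        have h4 : |x| * ℓ ≤ C * y ^ (1 / 4 : ℝ) * (q / τ) := mul_le_mul hx hreg hℓ0 (by positivity)
        have e2 : C * y ^ (1 / 4 : ℝ) * (q / τ) = C * (y ^ (1 / 4 : ℝ) * q) / τ := by ring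
        linarith
      have h4 : w = Real.exp (-(1 / 5 * Real.log y)) := by
        rw [hwdef, Real.rpow_def_of_pos hy0]; ring_nf
      have hprod : Δ ≤ Real.exp (-(1 / 5 * Real.log y)) *
          (Real.exp (-(K' * y)) * Real.exp (-(y ^ (6 / 5 : ℝ) / (4 * τ))) *
            Real.exp (-(C * y ^ (17 / 20 : ℝ) / τ))) := by
        rw [hΔ, ← Real.exp_add, ← Real.exp_add, ← Real.exp_add, Real.exp_le_exp]
        linarith
      refine hprod.trans ?_
      rw [h4, hW'def]
      refine mul_le_mul_of_nonneg_left ?_ (Real.exp_pos _).le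
      have i1 : Real.exp (-(K' * y)) * Real.exp (-(y ^ (6 / 5 : ℝ) / (4 * τ))) ≤
          ‖D.dobnerGammaT t s‖ * Real.exp (-(τ / 4) * ℓ ^ 2) :=
        mul_le_mul hγ h2 (Real.exp_pos _).le (norm_nonneg _)
      exact mul_le_mul i1 h3 (Real.exp_pos _).le (mul_nonneg (norm_nonneg _) (Real.exp_pos _).le)
  constructor
  · -- part (i)
    intro hℓ13
    have hreg : ℓ ≤ q / τ := by
      refine hℓ13.trans (div_le_div_of_nonneg_right ?_ hτ.le)
      exact Real.rpow_le_rpow_of_exponent_le hy1 (by norm_num)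
    obtain ⟨hcore, -⟩ := core hreg
    -- `main_A = main · e^δ`
    set δ : ℂ := ((τ / 4 * ℓ ^ 2 : ℝ) : ℂ) - (ℓ : ℂ) ^ 2 / (4 * A) with hδdef
    have hmainAeq : mainA = main * Complex.exp δ := by
      have e1 : Complex.exp (-((ℓ : ℂ) ^ 2 / (4 * A))) =
          Complex.exp ((-(τ / 4 * ℓ ^ 2) : ℝ) : ℂ) * Complex.exp δ := by
        rw [← Complex.exp_add]; congr 1; rw [hδdef]; push_cast; ring
      rw [hmainA, e1, hmain, dobnerMainTerm, ← hτdef, ← hℓdef]; push_cast; ring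
    have hδ : ‖δ‖ ≤ w / 8 := by
      have h1 := norm_delta_le ht0 hAη hη2 ℓ
      rw [← hτdef] at h1
      have h2 : τ * ℓ ^ 2 / 2 * ‖η‖ ≤ τ * ℓ ^ 2 / 2 * (τ * W₀ / y) :=
        mul_le_mul_of_nonneg_left hη (by positivity)
      have h3 : τ ^ 2 * ℓ ^ 2 ≤ y ^ (2 / 3 : ℝ) := by
        have h31 : τ * ℓ ≤ y ^ (1 / 3 : ℝ) := by
          rw [← le_div_iff₀' hτ]; exact hℓ13
        have h0 : 0 ≤ τ * ℓ := by positivity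
        calc τ ^ 2 * ℓ ^ 2 = (τ * ℓ) ^ 2 := by ring
          _ ≤ (y ^ (1 / 3 : ℝ)) ^ 2 := pow_le_pow_left₀ h0 h31 2
          _ = y ^ (2 / 3 : ℝ) := by rw [← Real.rpow_natCast _ 2, ← Real.rpow_mul hy0.le]; norm_num
      have h5 : W₀ * (τ ^ 2 * ℓ ^ 2) ≤ W₀ * y ^ (2 / 3 : ℝ) := mul_le_mul_of_nonneg_left h3 hW₀
      have h6 : W₀ * y ^ (2 / 3 : ℝ) / (2 * y) ≤ w / 8 := by
        rw [div_le_div_iff₀ (by positivity) (by norm_num)]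
        nlinarith [hwy, hW45]
      calc ‖δ‖ ≤ τ * ℓ ^ 2 / 2 * (τ * W₀ / y) := h1.trans h2
        _ = W₀ * (τ ^ 2 * ℓ ^ 2) / (2 * y) := by field_simp
        _ ≤ W₀ * y ^ (2 / 3 : ℝ) / (2 * y) := div_le_div_of_nonneg_right h5 (by positivity)
        _ ≤ w / 8 := h6
    have hδ1 : ‖δ‖ ≤ 1 / 8 := by linarith
    have hexpn : Real.exp ‖δ‖ ≤ 5 / 4 := by
      have h := Real.abs_exp_sub_one_le (x := ‖δ‖) (by rw [abs_of_nonneg (norm_nonneg _)]; linarith)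
      rw [abs_of_nonneg (norm_nonneg δ)] at h
      have := (abs_le.1 h).2
      linarith
    have hexpδ : ‖Complex.exp δ‖ ≤ 2 := (Complex.norm_exp_le_exp_norm δ).trans (by linarith)
    have hexpδ1 : ‖Complex.exp δ - 1‖ ≤ w / 2 := by
      refine (norm_cexp_sub_one_le δ).trans ?_
      calc 2 * ‖δ‖ * Real.exp ‖δ‖ ≤ 2 * (w / 8) * (5 / 4) := by gcongr
        _ ≤ w / 2 := by linarith
    have hmainA2 : ‖mainA‖ ≤ 2 * W' := by
      rw [hmainAeq, norm_mul, hmain_norm]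
      calc W' * ‖Complex.exp δ‖ ≤ W' * 2 := mul_le_mul_of_nonneg_left hexpδ hW'n
        _ = 2 * W' := by ring
    -- the three terms
    have T1 : ‖((cτ : ℝ) : ℂ) * MI - mainA * g‖ ≤ cτ * (2 * W' * (K₁ * w * Mτ + w)) := by
      refine hcore.trans (mul_le_mul_of_nonneg_left ?_ hcτ0.le)
      exact mul_le_mul hmainA2 (by linarith) (by positivity) (by positivity)
    have T2 : ‖mainA * (g - 1)‖ ≤ 2 * W' * w := by
      rw [norm_mul]; exact mul_le_mul hmainA2 (hg1.trans hηw) (norm_nonneg _) (by positivity)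
    have T3 : ‖mainA - main‖ ≤ W' * (w / 2) := by
      rw [hmainAeq, ← mul_sub_one, norm_mul, hmain_norm]
      exact mul_le_mul_of_nonneg_left hexpδ1 hW'n
    have e : ((cτ : ℝ) : ℂ) * MI - main =
        (((cτ : ℝ) : ℂ) * MI - mainA * g) + mainA * (g - 1) + (mainA - main) := by ring
    rw [e, hmain_norm]
    calc ‖((cτ : ℝ) : ℂ) * MI - mainA * g + mainA * (g - 1) + (mainA - main)‖
        ≤ ‖((cτ : ℝ) : ℂ) * MI - mainA * g‖ + ‖mainA * (g - 1)‖ + ‖mainA - main‖ := norm_add₃_le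
      _ ≤ cτ * (2 * W' * (K₁ * w * Mτ + w)) + 2 * W' * w + W' * (w / 2) :=
          add_le_add (add_le_add T1 T2) T3
      _ = (5 / 2 + 2 * cτ * (K₁ * Mτ + 1)) * w * W' := by ring
      _ ≤ K * w * W' := by
          refine mul_le_mul_of_nonneg_right (mul_le_mul_of_nonneg_right ?_ hw0.le) hW'n
          rw [hKdef]
          have : 0 ≤ 2 * cτ * Sτ := by positivity
          linarith only [this]
  · -- part (ii)
    intro hreg'
    have hreg : ℓ ≤ q / τ := hreg'
    obtain ⟨hcore, hΔW⟩ := core hreg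
    refine ⟨?_, ?_⟩
    · have T1 : ‖((cτ : ℝ) : ℂ) * MI - mainA * g‖ ≤ cτ * (W * (K₁ * Mτ + Sτ)) := by
        refine hcore.trans (mul_le_mul_of_nonneg_left ?_ hcτ0.le)
        refine mul_le_mul hWle ?_ (by positivity) hWn
        have : K₁ * w * Mτ ≤ K₁ * 1 * Mτ := by gcongr
        linarith
      have T2 : ‖mainA * g‖ ≤ W * 2 := by
        rw [norm_mul]; exact mul_le_mul hWle hg2 (norm_nonneg _) hWn
      have T3 : ‖((cτ : ℝ) : ℂ) * MI‖ ≤ ‖((cτ : ℝ) : ℂ) * MI - mainA * g‖ + ‖mainA * g‖ := by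
        have := norm_add_le (((cτ : ℝ) : ℂ) * MI - mainA * g) (mainA * g)
        rwa [sub_add_cancel] at this
      have hKW : (2 + cτ * (K₁ * Mτ + Sτ)) * W ≤ K * W := by
        refine mul_le_mul_of_nonneg_right ?_ hWn
        rw [hKdef]
        have : 0 ≤ cτ * (K₁ * Mτ + Sτ) := by positivity
        linarith only [this, hcτ0.le]
      have efin : K * ‖D.dobnerGammaT t s‖ * Real.exp (-(τ / 8) * ℓ ^ 2) * (n : ℝ) ^ (-x) =
          K * W := by
        rw [hWdef]; ring
      rw [efin]
      linarith
    · rw [hmain_norm]; exact hΔW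

end ExtendedSelbergDatum

end Literature.NumberTheory.LFunctions

end
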